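import Summits.BirchSwinnertonDyer.BirchSwinnertonDyer.Theses.ByReductionTypeAtTwo
import Summits.BirchSwinnertonDyer.BirchSwinnertonDyer.Theorems.ByReductionTypeAtTwoSupersingularUniformFlatLineFineMu
import Summits.BirchSwinnertonDyer.BirchSwinnertonDyer.Theorems.ByReductionTypeAtTwoSupersingularFlatLocalDataOfHondaSystem
import Summits.BirchSwinnertonDyer.Rank1Residual.F1Sign2.HondaSystemAtTwo
import Literature.NumberTheory.EllipticCurves.Kato2004.EulerSystemBoundFineSelmerTwo
import Literature.NumberTheory.EllipticCurves.Kato2004.MainConjecturePrimeTDoorProofs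
import Literature.NumberTheory.EllipticCurves.TateModuleFreeProofs
import Literature.NumberTheory.EllipticCurves.Rank1Residual.Predicates
import HarnessLib

/-!
# D-imc-88 — the ♭ PACKAGE SIGNATURE for reshape v2.16 of line `odd_blind_package` (crux `SupersingularRankZeroAtTwo`,
# item stmt-BirchSwinnertonDyer-19097), typed by the IMC-lens seat, with a SORRY-FREE kernel to stub 2 of record

Cell `bsd-f1-sign2`, seat `-imc` g35 (planner-of-record; LENS = Iwasawa main conjecture: «what Kato's divisibility gives at 2 and
where the 2-adic error terms sit»).  PUBLISH-ONLY crux workfile: no registry verb is run by `-imc`; the LEAD (bsd-2adic ss-1) cuts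
v2.16 bytes on the director's word.  HONEST FRAMING: two `def`s (statement candidates) + theorems; no `sorry`, no instance, no named
fact introduced; closes no item; the crux is NOT proved; BSD is proved for no curve.

## What the LEAD asked (HAND-TARGETS-FLATDATA-1 + ADDENDUM 1, STATUS 15:42Z) and what this file answers

Stub 2 of record `UniformFlatHondaDataAtTwo` (registry v2.14 l.1623–1688) = (1)–(6) local Honda data ∧ (7) COUNT♭ ∧ (8) CK♭
= F1♭ (two exactness clauses) ∧ «`G ∈ loc(Z)`, `ι G = C(ϖ)·ι L♭`» ∧ F4rat(`Z`) at every height-one `𝔭 ∌ 2`.  The LEAD's reshape: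
(1)–(6) ⟸ (C1) `F1Sign2.HondaSystemAtTwoExists` (★★ p827135), F4rat BY NAME from Kato Thm. 13.4 (2) at `2`
(`Kato2004.thm13_4_two_lengthAt_fineSelmerDual_le_of_isEulerSystemClassTwo`, ★★ p827226), and ONE new stub `stub_flatPackage` =
COUNT♭ ∧ F1♭ ∧ F3 «with the ZetaBody datum BOUND and `s :=` its unique Λ-adic lift».

**Lens finding (§10.121 of MEMO-imc).**  The literal binding «for THE lift `s` of a bound `ZetaBody` datum: `C(ϖ)·L♭ ∈ loc(Λs)`» is
FALSE as a `∀`, for two independent reasons, both sitting exactly «where the 2-adic error terms sit»: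
(E0) SCALING — `ZetaBody W 2 f ι κ' Λ' c d a A z x → ZetaBody W 2 f ι (2κ') Λ' c d a A (2z) (2x)` (every clause (C1)–(C5) of
`Kato2004.EulerSystemValues.ZetaBody` is linear in `(κ', z, x)`; the fact `exists_eulerSystem_expStar_values` pins `κ' ≠ 0` ONLY — «any
`ω_E`-normalisation of `κ` is the consumer's `hNorm`», its docstring), so no statement pinning the Coleman VALUE of the lift of an
arbitrary witness can hold; (E4) KATO'S MULTIPLIER — the lift of the guarded `(c, d, a, A)`-family has ♭-Coleman image
`κ″·μ̃_{c,d,a,A}·L♭` with `μ̃` the four-cusp multiplier (`EulerSystemValues.cuspFactor`; for `A ∣ c − 1, d − 1` it is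
`[a/A]⁻·(c² − cσ_c)(d² − dσ_d)`), and at `p = 2` the factor `c² − cσ_c ∈ ℤ₂⟦T⟧` is NEVER a unit (`c(c − 1)` is even), whereas at odd `p`
Kato's choice `c ≢ 0, 1 (p)` makes it one (§13.9–13.14).  Kato's own road divides `μ̃` out in `𝐇¹ ⊗ ℚ` (`z_γ`, Thm. 12.5 (1)–(3): NO parity
hypothesis — this is «what Kato's divisibility gives at 2»: the package UP TO A POWER OF 2, the TP2 cell's K3 currency) and recovers
integrality of `z_γ` only for `p ≠ 2` under (12.5.2) (Thm. 12.5 (4), via 12.4 (3) `𝐇¹` free, `p ≠ 2`); Wuthrich 2014 extends integrality to all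
ODD good `p` and records that modular-symbol integrality FAILS at `p = 2` (Doc. Math. 19, Thm. 4 and p. 383).  So the EXACT clause (8) hides
precisely: (E1) the `2`-adic unit normalisation `κ″ ↔ ϖ` (Manin constant / Néron-vs-modular lattice index at `2`), (E2) `2`-integrality of
`z_γ` in `𝐇¹(T₂W)`, (E3) `μ` at `𝔭 = (2)` (stub 3, not here), (E4) the multiplier, handled per prime `𝔭 ∌ 2` by AVOIDANCE (Kato §13.12;
in the tree for `p = 2`: `SignedKatoOffTwo.CuspEval.exists_cuspElement_not_mem_of_rohrlich`, conditional on Rohrlich = tree theorem).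

**The typed answer.**  `FlatZetaLineAtTwo` («ZL2») = the VALUE-PINNED zeta line at `2`: `∃ s₀ ∈ 𝐇¹_Γ` with `C(ϖ)·L♭ ∈ loc(Λs₀)` (this pins
`s₀` — no scaling ambiguity) such that at every height-one `𝔭 ∌ 2` some `M ∉ 𝔭` has `M•s₀ =` a NONZERO `2`-adic Euler-system class
(`Kato2004.IsEulerSystemClassTwo`, the tree's abstraction of «Λ-adic lift of an integral Euler system»).  ZL2 = (E1) + (E2) made into ONE
named clause (beyond print at `2`; at odd good `p` it is Kato 12.5 (4) ∘ Wuthrich Thm. 13 ∘ Kato 13.9–13.12 ∘ a ♭-reciprocity law READ from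
Kobayashi 2003 Thm. 8.25-type / Sprung 2012 Def. 6.1, Prop. 6.3–6.5); (E4) is then DISCHARGED IN THE KERNEL below by
`Kato2004.lengthAt_quotient_eq_of_localized_eq_submodule` (`Λ_𝔭 s = Λ_𝔭 s₀` when `M ∉ 𝔭`), and F4rat for `Z := Λs₀` follows BY NAME from
Thm. 13.4 (2) at `2` applied to the Euler class `s` — exactly the LEAD's «F4rat by name», but on a class where it is TRUE.
`FlatPackageAtTwo` = for the Honda data (1)–(6) GIVEN AS HYPOTHESES: (7) COUNT♭ verbatim ∧ (8′) := (8) with `(Z, F4rat)` replaced by ZL2.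
KERNEL (sorry-free): `uniformFlatHondaDataAtTwo_of_flatPackage : HondaSystemAtTwoExists → FlatPackageAtTwo →
thm13_4_two_lengthAt_fineSelmerDual_le_of_isEulerSystemClassTwo → UniformFlatHondaDataAtTwo` (the registry statement, restated
TOKEN-IDENTICALLY here because `Cruxes/…/Lines/*.lean` modules are not importable on the farm; v2.16 bytes use the registry's own decl).
Note: `Kato2004.exists_eulerSystem_expStar_values`, modularity and Rohrlich are NOT consumed by this kernel — they are what a PROVER of ZL2's
third conjunct uses (★★ p827226 `SSFlatRoad.flatKatoSide_two` produces the nonzero Euler classes; the relation `M • s₀ = s` to the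
value-pinned `s₀` is the beyond-print content, correctly isolated).

References: [Kato2004Asterisque] Thm. 12.4 (p. 221), Thm. 12.5 (1)–(4) and (12.5.2) (pp. 221–222), Thm. 12.6 (p. 222), (12.8.1) (p. 223),
§13.9–13.14 (pp. 229–234), Thm. 13.4 (2) (p. 226); [Wuthrich2014DocMath] C. Wuthrich, Doc. Math. 19 (2014) 381–402, Thm. 2, Thm. 4 (and the
remark after it, p. 383: fails at `p = 2`), Lemma 12, Thm. 13; [Sprung2012] Def. 6.1, Prop. 6.3–6.5, Thm. 7.14, 7.16, Prop. 7.19;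
[Kobayashi2003] Thm. 1.3, §8; [RohrlichInventiones1984] Theorem p. 409.
-/

set_option autoImplicit false
set_option linter.dupNamespace false
set_option linter.unusedVariables false

noncomputable section

open scoped Classical MatrixGroups ModularForm NumberField
open NumberField IsDedekindDomain CongruenceSubgroup WeierstrassCurve PowerSeries
open Literature.NumberTheory.EllipticCurves Literature.NumberTheory.EllipticCurves.IwasawaDual
  Literature.NumberTheory.EllipticCurves.Sprung2012 Literature.NumberTheory.EllipticCurves.Sprung2017
  Literature.NumberTheory.EllipticCurves.ModularForms
  Literature.NumberTheory.EllipticCurves.Rank1Residual Literature.NumberTheory.EllipticCurves.Rank1Residual.Typed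
  Literature.NumberTheory.EllipticCurves.Kobayashi2003 Literature.NumberTheory.GaloisRepresentations ZpExtension
open Summit.BirchSwinnertonDyer.Rank1Residual Summit.BirchSwinnertonDyer.Rank1Residual.Supersingular

namespace Summit.BirchSwinnertonDyer.BirchSwinnertonDyer.Cruxes.SupersingularRankZeroAtTwo.D88

/-! ## §0 Stub 2 of record, restated token-identically (registry `Lines/odd_blind_package.lean` v2.14 l.1623–1688) -/

/-- `UniformFlatHondaDataAtTwo` — TOKEN-IDENTICAL restatement of the registry statement of `stub_allFlatData` (line `odd_blind_package`
v2.14, sha16 bb48bf0d237db8c9, l.1623–1688); restated only because `Cruxes/…/Lines` modules are not importable on the farm.  Sprung's ♭ local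
Coleman data at `v ∋ 2` with the Honda₂ clauses (1)–(6) ∧ (7) COUNT♭@2 ∧ (8) CK♭@2.  BEYOND PRINT AT 2.
[cite: Sprung2012, Thm. 2.2, Lemma 7.9, 7.14, 7.16] [cite: Kato2004Asterisque, Thm. 12.5 (pp. 221–222)] -/
def UniformFlatHondaDataAtTwo : Prop :=
      ∀ (W : WeierstrassCurve ℚ) [W.IsElliptic] [W.IsGloballyMinimal],
      ¬ W.HasCM → W.analyticRank = 0 → GoodSS W 2 →
      ∀ (κ : ZpExtension ℚ 2) (γ : Field.absoluteGaloisGroup ℚ),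
        κ.IsCyclotomic → κ.IsTopGenerator γ → IsCyclotomicVariable 2 γ →
      ∀ (v : HeightOneSpectrum (𝓞 ℚ)), (2 : 𝓞 ℚ) ∈ v.asIdeal →
      ∃ (g : Field.absoluteGaloisGroup (v.adicCompletion ℚ)) (c : ℕ → localPoints W (v.adicCompletion ℚ)),
        κ.IsTopGenerator (resGalOfEmb (closureEmb (K := ℚ) (v.adicCompletion ℚ)) g) ∧
        (∀ n, c n ∈ localLayerPointsOfEmb κ (closureEmb (K := ℚ) (v.adicCompletion ℚ)) W n) ∧
        (∀ n, 1 ≤ n → localTraceOfEmb κ (closureEmb (K := ℚ) (v.adicCompletion ℚ)) W n (n + 1)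
          (c (n + 1)) = W.frobeniusTrace 2 • c n - c (n - 1)) ∧
        (∀ z₀ : localLayerPointsOfEmb κ (closureEmb (K := ℚ) (v.adicCompletion ℚ)) W 0 →+ ℤ_[2],
          evalOn W (localLayerPointsOfEmb κ (closureEmb (K := ℚ) (v.adicCompletion ℚ)) W 0) z₀ (c 0) = 0 →
            z₀ = 0) ∧
        (∀ a : ℤ_[2],
          (∃ z₀ : localLayerPointsOfEmb κ (closureEmb (K := ℚ) (v.adicCompletion ℚ)) W 0 →+ ℤ_[2],
            evalOn W (localLayerPointsOfEmb κ (closureEmb (K := ℚ) (v.adicCompletion ℚ)) W 0) z₀ (c 0) =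
              2 * a) →
          ∃ y : localLayerPointsOfEmb κ (closureEmb (K := ℚ) (v.adicCompletion ℚ)) W 0 →+ ℤ_[2],
            evalOn W (localLayerPointsOfEmb κ (closureEmb (K := ℚ) (v.adicCompletion ℚ)) W 0) y (c 0) = a) ∧
        (∃ cneg : localPoints W (v.adicCompletion ℚ),
          Summit.BirchSwinnertonDyer.Rank1Residual.F1Sign2.IsHondaSystemAtTwo κ
            (closureEmb (K := ℚ) (v.adicCompletion ℚ)) W (W.frobeniusTrace 2) g cneg c) ∧
        (Finite (W.selmerGroupPInfty 2) →
          Finite (EndCoinvariants (conjSharpFlatSelmerInfty W κ (closureEmb (K := ℚ) (v.adicCompletion ℚ))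
            (W.frobeniusTrace 2) g c .flat γ - 1)) →
          Nat.card (↥((sharpFlatSelmerInfty W κ (closureEmb (K := ℚ) (v.adicCompletion ℚ))
                (W.frobeniusTrace 2) g c .flat).comap (W.layerToInfty κ 0)) ⧸
              (W.selmerLayer κ 0).addSubgroupOf
                ((sharpFlatSelmerInfty W κ (closureEmb (K := ℚ) (v.adicCompletion ℚ))
                  (W.frobeniusTrace 2) g c .flat).comap (W.layerToInfty κ 0))) *
            Nat.card (MulAction.fixedPoints (Field.absoluteGaloisGroup ℚ) (W.geomPrimaryTorsion 2)) =
          2 ^ (padicValNat 2 W.tamagawaProduct) *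
            Nat.card (EndCoinvariants (conjSharpFlatSelmerInfty W κ
              (closureEmb (K := ℚ) (v.adicCompletion ℚ)) (W.frobeniusTrace 2) g c .flat γ - 1))) ∧
        (∀ [NeZero (W.conductorNorm ℤ)] (f : CuspForm (Gamma0 (W.conductorNorm ℤ)) 2),
            IsNewformOf W f → ∀ (ϖ : ℚ), (ϖ : ℝ) * W.realPeriodRat = plusPeriod f →
          ∀ (Ls Lf : IwasawaAlgebra 2), IsSprungPair f 2 (W.frobeniusTrace 2) Ls Lf →
          ∀ (D : SharpFlatSelmerDualData W κ γ (closureEmb (K := ℚ) (v.adicCompletion ℚ))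
              (W.frobeniusTrace 2) g c .flat) [ContinuousSMul ℤ_[2] (W.tateModule 2)],
            ∃ (I : Kato2004.IwasawaH1Data W 2 κ γ) (Y : W.FineSelmerDualData κ γ)
              (P : Submodule (IwasawaAlgebra 2) (IwasawaAlgebra 2))
              (loc : I.H →ₗ[IwasawaAlgebra 2] P) (toX : P →ₗ[IwasawaAlgebra 2] D.X)
              (δ : D.X →ₗ[IwasawaAlgebra 2] Y.X) (Z : Submodule (IwasawaAlgebra 2) I.H)
              (G : IwasawaAlgebra 2),
              Function.Exact loc toX ∧ Function.Exact toX δ ∧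
              G ∈ Submodule.map (P.subtype ∘ₗ loc) Z ∧
              iwasawaToPowerSeries 2 G = PowerSeries.C (ϖ : ℚ_[2]) * iwasawaToPowerSeries 2 Lf ∧
              (∀ 𝔭 : PrimeSpectrum (IwasawaAlgebra 2), 𝔭.asIdeal.height = 1 →
                PowerSeries.C (2 : ℤ_[2]) ∉ 𝔭.asIdeal →
                Literature.NumberTheory.EllipticCurves.Module.lengthAt (IwasawaAlgebra 2) Y.X 𝔭 ≤
                  Literature.NumberTheory.EllipticCurves.Module.lengthAt (IwasawaAlgebra 2) (I.H ⧸ Z) 𝔭))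

/-! ## §1 ZL2 — the VALUE-PINNED zeta line at `2` (the lens's candidate for the exact clause of F3♭, replacing `(Z, F4rat)` of (8)) -/

/-- **ZL2 `FlatZetaLineAtTwo` (candidate, BEYOND PRINT at `2`).**  For a pinned `𝐇¹_Γ(T₂W)` (`I`), a local target `P ⊆ Λ` with
`loc : 𝐇¹_Γ → P` (in the package: Sprung's ♭ Coleman map after localisation at `v ∋ 2`), a period ratio `ϖ` and `L♭ ∈ Λ`: there is a class
`s₀ ∈ 𝐇¹_Γ` — Kato's `z_γ` for the Néron lattice, made `2`-INTEGRAL — with (i) `C(ϖ)·ι L♭ = ι G` for some `G ∈ loc(Λ s₀)` (explicit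
reciprocity ∘ ♭-interpolation with the EXACT `Ω_W`-normalisation: error terms (E1) Manin/lattice index at `2` and (E2) `2`-integrality of
`z_γ`), and (ii) at every height-one `𝔭 ∌ 2` of `Λ = ℤ₂⟦T⟧` a multiplier `M ∉ 𝔭` and a NONZERO `2`-adic Euler-system class `s`
(`Kato2004.IsEulerSystemClassTwo`: Λ-adic lift of an integral Euler system on the cyclotomic levels) with `M • s₀ = s` (Kato's
`_{c,d}z = μ̃(c,d,a,A)·z_γ`, §13.9–13.11, with the per-prime AVOIDANCE `μ̃ ∉ 𝔭`, §13.12 — at `p = 2` the multiplier is never a unit, so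
avoidance is needed even rationally; tree: `SignedKatoOffTwo.CuspEval.exists_cuspElement_not_mem_of_rohrlich`).  At odd good `p` (i)–(ii)
are Kato Thm. 12.5 (1)(4) + Wuthrich 2014 Thm. 13 + a ♭/± reciprocity law (Kobayashi 2003 Thm. 8.25-type, Sprung 2012 §6); at `p = 2`,
12.5 (4) is not in print (hypothesis `p ≠ 2`) and Wuthrich's Thm. 4 fails (p. 383).  A PREDICATE; nothing asserted.
[cite: Kato2004Asterisque, Thm. 12.5 (1)–(4) (pp. 221–222), §13.9–13.12 (pp. 229–233)] [cite: Sprung2012, Def. 6.1, Prop. 6.3–6.5, Prop. 7.19] -/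
def FlatZetaLineAtTwo (W : WeierstrassCurve ℚ) [W.IsElliptic] [ContinuousSMul ℤ_[2] (W.tateModule 2)]
    [Module.Free ℤ_[2] (W.tateModule 2)] [Module.Finite ℤ_[2] (W.tateModule 2)]
    {κ : ZpExtension ℚ 2} {γ : Field.absoluteGaloisGroup ℚ} (hκ : κ.IsCyclotomic)
    (I : Kato2004.IwasawaH1Data W 2 κ γ) (P : Submodule (IwasawaAlgebra 2) (IwasawaAlgebra 2))
    (loc : I.H →ₗ[IwasawaAlgebra 2] P) (ϖ : ℚ) (Lf : IwasawaAlgebra 2) : Prop :=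
  ∃ (s₀ : I.H) (G : IwasawaAlgebra 2),
    G ∈ Submodule.map (P.subtype ∘ₗ loc) (Submodule.span (IwasawaAlgebra 2) {s₀}) ∧
    iwasawaToPowerSeries 2 G = PowerSeries.C (ϖ : ℚ_[2]) * iwasawaToPowerSeries 2 Lf ∧
    ∀ 𝔭 : PrimeSpectrum (IwasawaAlgebra 2), 𝔭.asIdeal.height = 1 →
      PowerSeries.C (2 : ℤ_[2]) ∉ 𝔭.asIdeal →
      ∃ (M : IwasawaAlgebra 2) (s : I.H), M ∉ 𝔭.asIdeal ∧
        Kato2004.IsEulerSystemClassTwo W hκ I s ∧ s ≠ 0 ∧ M • s₀ = s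

/-! ## §2 The ♭ package (candidate signature of `stub_flatPackage` for v2.16) -/

/-- **`FlatPackageAtTwo` — candidate statement of `stub_flatPackage` (reshape v2.16; D-imc-88).**  For every curve of the crux habitat
(`W` globally minimal, non-CM, `r_an = 0`, good supersingular at `2`), the cyclotomic datum `(κ, γ)`, `v ∋ 2`, and every local datum `(g, c)`
carrying the six Honda₂ clauses (1) lift · (2) levels · (3) Sprung trace · (4) dual gen₀ (a) · (5) (b) · (6) `IsHondaSystemAtTwo … g cneg c`
(ALL GIVEN AS HYPOTHESES — they are theorems under (C1), ★★ p827135): (7) COUNT♭@2 VERBATIM (the control count for `Sel♭` at layer `0`: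
Tamagawa `2`-parts and `E(ℚ)[2^∞]` against the `Γ`-coinvariants of the conjugate ♭ dual) ∧ (8′) for every newform `f` of `W`, period ratio
`ϖ`, Sprung pair `(L♯, L♭)` at `2` and pinned ♭ dual `D`: a Poitou–Tate/Coleman skeleton `𝐇¹_Γ →loc P ⊆ Λ`, `P →toX X♭ →δ X⁰` with F1♭
(`Exact loc toX`, `Exact toX δ`) ∧ ZL2 `FlatZetaLineAtTwo W hκ I P loc ϖ L♭`.  (8′) = clause (8) of stub 2 with `(Z, F4rat)` replaced by the
value-pinned zeta line (and the two Prop-instance binders `[Module.Free/Finite ℤ_[2] (T₂W)]` that `IsEulerSystemClassTwo` carries — THEOREMS,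
`module_free_tateModule_holds`, `module_finite_tateModule_holds`, supplied in the kernel); F4rat is recovered in the kernel from Kato
Thm. 13.4 (2) at `2`.  PRINT at odd `p` for F1♭ (Kobayashi 2003
Thm. 1.2/7.3, Sprung 2012 Thm. 7.14, 7.16, Prop. 7.19), READ at `2`; COUNT♭ and ZL2 BEYOND PRINT at `2`.  A statement candidate; nothing
asserted; the crux is NOT proved.
[cite: Sprung2012, Def. 6.1, Thm. 7.14, 7.16, Prop. 7.19] [cite: Kobayashi2003, Thm. 1.2, Thm. 1.3] [cite: Kato2004Asterisque, Thm. 12.5, Thm. 13.4 (2)] -/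
def FlatPackageAtTwo : Prop :=
      ∀ (W : WeierstrassCurve ℚ) [W.IsElliptic] [W.IsGloballyMinimal],
      ¬ W.HasCM → W.analyticRank = 0 → GoodSS W 2 →
      ∀ (κ : ZpExtension ℚ 2) (γ : Field.absoluteGaloisGroup ℚ) (hκ : κ.IsCyclotomic),
        κ.IsTopGenerator γ → IsCyclotomicVariable 2 γ →
      ∀ (v : HeightOneSpectrum (𝓞 ℚ)), (2 : 𝓞 ℚ) ∈ v.asIdeal →
      ∀ (g : Field.absoluteGaloisGroup (v.adicCompletion ℚ)) (c : ℕ → localPoints W (v.adicCompletion ℚ)),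
        κ.IsTopGenerator (resGalOfEmb (closureEmb (K := ℚ) (v.adicCompletion ℚ)) g) →
        (∀ n, c n ∈ localLayerPointsOfEmb κ (closureEmb (K := ℚ) (v.adicCompletion ℚ)) W n) →
        (∀ n, 1 ≤ n → localTraceOfEmb κ (closureEmb (K := ℚ) (v.adicCompletion ℚ)) W n (n + 1)
          (c (n + 1)) = W.frobeniusTrace 2 • c n - c (n - 1)) →
        (∀ z₀ : localLayerPointsOfEmb κ (closureEmb (K := ℚ) (v.adicCompletion ℚ)) W 0 →+ ℤ_[2],
          evalOn W (localLayerPointsOfEmb κ (closureEmb (K := ℚ) (v.adicCompletion ℚ)) W 0) z₀ (c 0) = 0 →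
            z₀ = 0) →
        (∀ a : ℤ_[2],
          (∃ z₀ : localLayerPointsOfEmb κ (closureEmb (K := ℚ) (v.adicCompletion ℚ)) W 0 →+ ℤ_[2],
            evalOn W (localLayerPointsOfEmb κ (closureEmb (K := ℚ) (v.adicCompletion ℚ)) W 0) z₀ (c 0) =
              2 * a) →
          ∃ y : localLayerPointsOfEmb κ (closureEmb (K := ℚ) (v.adicCompletion ℚ)) W 0 →+ ℤ_[2],
            evalOn W (localLayerPointsOfEmb κ (closureEmb (K := ℚ) (v.adicCompletion ℚ)) W 0) y (c 0) = a) →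
      ∀ (cneg : localPoints W (v.adicCompletion ℚ)),
        Summit.BirchSwinnertonDyer.Rank1Residual.F1Sign2.IsHondaSystemAtTwo κ
            (closureEmb (K := ℚ) (v.adicCompletion ℚ)) W (W.frobeniusTrace 2) g cneg c →
        (Finite (W.selmerGroupPInfty 2) →
          Finite (EndCoinvariants (conjSharpFlatSelmerInfty W κ (closureEmb (K := ℚ) (v.adicCompletion ℚ))
            (W.frobeniusTrace 2) g c .flat γ - 1)) →
          Nat.card (↥((sharpFlatSelmerInfty W κ (closureEmb (K := ℚ) (v.adicCompletion ℚ))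
                (W.frobeniusTrace 2) g c .flat).comap (W.layerToInfty κ 0)) ⧸
              (W.selmerLayer κ 0).addSubgroupOf
                ((sharpFlatSelmerInfty W κ (closureEmb (K := ℚ) (v.adicCompletion ℚ))
                  (W.frobeniusTrace 2) g c .flat).comap (W.layerToInfty κ 0))) *
            Nat.card (MulAction.fixedPoints (Field.absoluteGaloisGroup ℚ) (W.geomPrimaryTorsion 2)) =
          2 ^ (padicValNat 2 W.tamagawaProduct) *
            Nat.card (EndCoinvariants (conjSharpFlatSelmerInfty W κ
              (closureEmb (K := ℚ) (v.adicCompletion ℚ)) (W.frobeniusTrace 2) g c .flat γ - 1))) ∧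
        (∀ [NeZero (W.conductorNorm ℤ)] (f : CuspForm (Gamma0 (W.conductorNorm ℤ)) 2),
            IsNewformOf W f → ∀ (ϖ : ℚ), (ϖ : ℝ) * W.realPeriodRat = plusPeriod f →
          ∀ (Ls Lf : IwasawaAlgebra 2), IsSprungPair f 2 (W.frobeniusTrace 2) Ls Lf →
          ∀ (D : SharpFlatSelmerDualData W κ γ (closureEmb (K := ℚ) (v.adicCompletion ℚ))
              (W.frobeniusTrace 2) g c .flat) [ContinuousSMul ℤ_[2] (W.tateModule 2)]
              [Module.Free ℤ_[2] (W.tateModule 2)] [Module.Finite ℤ_[2] (W.tateModule 2)],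
            ∃ (I : Kato2004.IwasawaH1Data W 2 κ γ) (Y : W.FineSelmerDualData κ γ)
              (P : Submodule (IwasawaAlgebra 2) (IwasawaAlgebra 2))
              (loc : I.H →ₗ[IwasawaAlgebra 2] P) (toX : P →ₗ[IwasawaAlgebra 2] D.X)
              (δ : D.X →ₗ[IwasawaAlgebra 2] Y.X),
              Function.Exact loc toX ∧ Function.Exact toX δ ∧
              FlatZetaLineAtTwo W hκ I P loc ϖ Lf)

/-! ## §3 Algebra of the multiplier: `Λ_𝔭 s = Λ_𝔭 s₀` when `s = M • s₀`, `M ∉ 𝔭` -/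

/-- If `s = M • s₀` then `M·(Λ s₀) ⊆ Λ s`. [folklore] -/
theorem smul_mem_span_of_smul_eq {R : Type*} [CommRing R] {H : Type*} [AddCommGroup H] [Module R H]
    {M : R} {s₀ s : H} (hMs : M • s₀ = s) :
    ∀ x ∈ Submodule.span R {s₀}, M • x ∈ Submodule.span R {s} := by
  intro x hx
  obtain ⟨a, rfl⟩ := Submodule.mem_span_singleton.mp hx
  exact Submodule.mem_span_singleton.mpr ⟨a, by rw [← hMs, smul_smul, smul_smul, mul_comm]⟩

/-- If `s = M • s₀` then `M·(Λ s) ⊆ Λ s₀` (indeed `Λ s ⊆ Λ s₀`). [folklore] -/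
theorem smul_mem_span_of_eq_smul {R : Type*} [CommRing R] {H : Type*} [AddCommGroup H] [Module R H]
    {M : R} {s₀ s : H} (hMs : M • s₀ = s) :
    ∀ x ∈ Submodule.span R {s}, M • x ∈ Submodule.span R {s₀} := by
  intro x hx
  obtain ⟨b, rfl⟩ := Submodule.mem_span_singleton.mp hx
  exact Submodule.mem_span_singleton.mpr ⟨M * b * M, by rw [← hMs, smul_smul, smul_smul, mul_assoc]⟩

/-- **Local lengths along the zeta line**: if `M ∉ 𝔭` and `M • s₀ = s` then `ℓ_𝔭(H/Λ s) = ℓ_𝔭(H/Λ s₀)` — Kato's multiplier is invisible at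
the primes it avoids (§13.12–13.14; tree: `Kato2004.lengthAt_quotient_eq_of_localized_eq_submodule`).
[cite: Kato2004Asterisque, §13.12–13.14 (pp. 231–234)] -/
theorem lengthAt_quotient_span_eq_of_smul_eq {H : Type*} [AddCommGroup H] [Module (IwasawaAlgebra 2) H]
    {M : IwasawaAlgebra 2} {s₀ s : H} (𝔭 : PrimeSpectrum (IwasawaAlgebra 2)) (hM : M ∉ 𝔭.asIdeal)
    (hMs : M • s₀ = s) :
    Literature.NumberTheory.EllipticCurves.Module.lengthAt (IwasawaAlgebra 2) (H ⧸ Submodule.span (IwasawaAlgebra 2) {s}) 𝔭 =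
      Literature.NumberTheory.EllipticCurves.Module.lengthAt (IwasawaAlgebra 2)
        (H ⧸ Submodule.span (IwasawaAlgebra 2) {s₀}) 𝔭 :=
  Kato2004.lengthAt_quotient_eq_of_localized_eq_submodule 𝔭 hM (smul_mem_span_of_smul_eq hMs)
    (smul_mem_span_of_eq_smul hMs)

/-! ## §4 KERNEL: stub 2 of record from (C1), the ♭ package and Kato Thm. 13.4 (2) at `2` — sorry-free -/

/-- **F4rat on the value-pinned zeta line, BY NAME from Kato Thm. 13.4 (2) at `2`.**  If `s₀` carries ZL2's local Euler multiples, then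
`ℓ_𝔭(X⁰) ≤ ℓ_𝔭(𝐇¹_Γ/Λ s₀)` at every height-one `𝔭 ∌ 2` (non-CM `W`): apply the named fact to the Euler class `s = M • s₀` and move along
`Λ_𝔭 s = Λ_𝔭 s₀`.  CONDITIONAL on the named fact `h134` (Kato Thm. 13.4 (2), PRINT). [cite: Kato2004Asterisque, Thm. 13.4 (2) (p. 226), §13.12] -/
theorem lengthAt_fineSelmerDual_le_of_flatZetaLine
    (h134 : Kato2004.thm13_4_two_lengthAt_fineSelmerDual_le_of_isEulerSystemClassTwo)
    (W : WeierstrassCurve ℚ) [W.IsElliptic] [ContinuousSMul ℤ_[2] (W.tateModule 2)]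
    [Module.Free ℤ_[2] (W.tateModule 2)] [Module.Finite ℤ_[2] (W.tateModule 2)] (hCM : ¬ W.HasCM)
    {κ : ZpExtension ℚ 2} {γ : Field.absoluteGaloisGroup ℚ} (hκ : κ.IsCyclotomic) (hγ : κ.IsTopGenerator γ)
    (I : Kato2004.IwasawaH1Data W 2 κ γ) (Y : W.FineSelmerDualData κ γ)
    (P : Submodule (IwasawaAlgebra 2) (IwasawaAlgebra 2)) (loc : I.H →ₗ[IwasawaAlgebra 2] P) (ϖ : ℚ)
    (Lf : IwasawaAlgebra 2) {s₀ : I.H}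
    (hloc : ∀ 𝔭 : PrimeSpectrum (IwasawaAlgebra 2), 𝔭.asIdeal.height = 1 →
      PowerSeries.C (2 : ℤ_[2]) ∉ 𝔭.asIdeal →
      ∃ (M : IwasawaAlgebra 2) (s : I.H), M ∉ 𝔭.asIdeal ∧
        Kato2004.IsEulerSystemClassTwo W hκ I s ∧ s ≠ 0 ∧ M • s₀ = s) :
    ∀ 𝔭 : PrimeSpectrum (IwasawaAlgebra 2), 𝔭.asIdeal.height = 1 →
      PowerSeries.C (2 : ℤ_[2]) ∉ 𝔭.asIdeal →
      Literature.NumberTheory.EllipticCurves.Module.lengthAt (IwasawaAlgebra 2) Y.X 𝔭 ≤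
        Literature.NumberTheory.EllipticCurves.Module.lengthAt (IwasawaAlgebra 2)
          (I.H ⧸ Submodule.span (IwasawaAlgebra 2) {s₀}) 𝔭 := by
  intro 𝔭 h1 h2
  obtain ⟨M, s, hM, hES, hs0, hMs⟩ := hloc 𝔭 h1 h2
  have h := h134 W hCM κ γ hκ hγ I Y s hES hs0 𝔭 h1 h2
  rwa [lengthAt_quotient_span_eq_of_smul_eq 𝔭 hM hMs] at h

/-- **KERNEL (D-imc-88): stub 2 of record ⟸ (C1) ∧ ♭ package ∧ Kato 13.4 (2) at `2`.**  `UniformFlatHondaDataAtTwo` (registry statement,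
restated token-identically in §0) from `F1Sign2.HondaSystemAtTwoExists` (the v2.16 stub `stub_hondaAtTwo`; (1)–(6) by ★★ p827135
`SSFlatLocalData.flatLocalData_of_hondaSystemAtTwoExists`), `FlatPackageAtTwo` (the v2.16 stub `stub_flatPackage`) and the named fact
`Kato2004.thm13_4_two_lengthAt_fineSelmerDual_le_of_isEulerSystemClassTwo` (PRINT, a `stub_pub` conjunct or kernel hypothesis at the LEAD's
choice): (7) verbatim; (8) with `Z := Λ s₀`, `G` from ZL2, F4rat by `lengthAt_fineSelmerDual_le_of_flatZetaLine`.  Sorry-free composition;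
CONDITIONAL on its three hypotheses; closes nothing by itself. [cite: Kato2004Asterisque, Thm. 13.4 (2) (p. 226)] [cite: Sprung2012, Thm. 2.2, Lemma 7.9] -/
theorem uniformFlatHondaDataAtTwo_of_flatPackage
    (hC1 : Summit.BirchSwinnertonDyer.Rank1Residual.F1Sign2.HondaSystemAtTwoExists)
    (hPkg : FlatPackageAtTwo)
    (h134 : Kato2004.thm13_4_two_lengthAt_fineSelmerDual_le_of_isEulerSystemClassTwo) :
    UniformFlatHondaDataAtTwo := by
  intro W _ _ hCM hr hss κ γ hκ hγ hγ' v hv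
  obtain ⟨g, c, hg, hc, hTr, hinj, hsat, ⟨cneg, hH⟩⟩ :=
    Summit.BirchSwinnertonDyer.BirchSwinnertonDyer.Theorems.SSFlatLocalData.flatLocalData_of_hondaSystemAtTwoExists
      hC1 W hCM hr hss κ γ hκ hγ hγ' v hv
  obtain ⟨hcount, hZ⟩ := hPkg W hCM hr hss κ γ hκ hγ hγ' v hv g c hg hc hTr hinj hsat cneg hH
  refine ⟨g, c, hg, hc, hTr, hinj, hsat, ⟨cneg, hH⟩, hcount, ?_⟩
  intro _ f hf ϖ hϖ Ls Lf hSP D _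
  haveI : Module.Free ℤ_[2] (W.tateModule 2) := module_free_tateModule_holds W 2
  haveI : Module.Finite ℤ_[2] (W.tateModule 2) := module_finite_tateModule_holds W 2
  obtain ⟨I, Y, P, loc, toX, δ, hex₁, hex₂, s₀, G, hG, hιG, hloc⟩ := hZ f hf ϖ hϖ Ls Lf hSP D
  exact ⟨I, Y, P, loc, toX, δ, Submodule.span (IwasawaAlgebra 2) {s₀}, G, hex₁, hex₂, hG, hιG,
    lengthAt_fineSelmerDual_le_of_flatZetaLine h134 W hCM hκ hγ I Y P loc ϖ Lf hloc⟩

/-! ## §5 The reshape, as the LEAD would cut it (nothing registered here): v2.16 stub 2 := the two hypotheses of the kernel -/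

/-- **v2.16 shape (advisory).**  With `stub_hondaAtTwo : HondaSystemAtTwoExists` and `stub_flatPackage : FlatPackageAtTwo` as the two
registered stubs replacing `stub_allFlatData`, and `h134` fed by name, the composition slot of `SupersingularRankZeroAtTwo_of` receives
`UniformFlatHondaDataAtTwo` unchanged — so every downstream token of v2.14 (`uniformFlatDataAtTwo_of_honda`, `bsdp_two_of_genericOdd`) is
byte-identical.  This theorem is that one line. [folklore] -/
theorem stub_allFlatData_of_v216
    (stub_hondaAtTwo : Summit.BirchSwinnertonDyer.Rank1Residual.F1Sign2.HondaSystemAtTwoExists)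
    (stub_flatPackage : FlatPackageAtTwo)
    (h134 : Kato2004.thm13_4_two_lengthAt_fineSelmerDual_le_of_isEulerSystemClassTwo) :
    UniformFlatHondaDataAtTwo :=
  uniformFlatHondaDataAtTwo_of_flatPackage stub_hondaAtTwo stub_flatPackage h134

end Summit.BirchSwinnertonDyer.BirchSwinnertonDyer.Cruxes.SupersingularRankZeroAtTwo.D88

end
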